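import Summits.QuantumFields.YangMills.Theorems.FemtoCurvatureSkewness.Negative.WildPackage

/-!
# `FemtoCurvatureSkewness` — negative-side support: the residual stub `PackagePinsScale` says exactly that the
# crux's hypothesis is never met (no uniformities needed)

Support file for crux `stmt-QuantumFields-9365` (`LangevinControlUV.FemtoCurvatureSkewness`), written by the standing
disprover (cdisprove, cycle 2) about line `Sketch-ideator3`'s residual stub
`PackagePinsScale := ∀ G simple, ∀ r a a', TwoPointPackage r a → TwoPointPackage r a' → ∃ ε > 0, ∀ᶠ β, ε·a β ≤ a' β`
("two unit maps carrying the two-point package are comparable"; verbatim copy below as `PackagePinsScale`).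

The lead's `WildPackage.exists_incomparable_packages` refutes the stub for `(G, r)` MODULO five covariance uniformities
(needed because the wild map there is SMALL, `a ≤ e^{-β}`, so its femto boxes are huge).  Here the wild map is taken
LARGE instead — squeezed between `g/2` and `g` for the envelope `g := √a₀ + a₀ ≥ a₀` of a GIVEN package map `a₀`
(`exists_wildMap_two_sided`, integer `log 2`-shifts of the lead's translation-free map).  Its femto boxes are then
contained in `a₀`'s boxes, and `a₀`'s OWN package transfers to it verbatim: read `Γ₀` off the corresponding `a₀`-level on
the (singleton) levels of the wild map, `1` elsewhere (`twoPointPackage_transfer` — pure bookkeeping, no physics).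
Since `a₀/a ≤ 2√a₀ → 0`, the two package maps are incomparable (`exists_incomparable_package_of_package`).  Hence

* `packagePinsScale_iff_package_unsatisfiable`:  `PackagePinsScale ↔ ∀ G simple, ∀ r a, ¬ TwoPointPackage r a` —
  the residual stub is EQUIVALENT to the unsatisfiability of the crux's (and `FemtoCurvatureTwoPoint`'s) two-point
  package; in particular it implies the crux VACUOUSLY (work file `Disproof.lean`,
  `femtoCurvatureSkewness_of_packagePinsScale`), so the line's engine stub is idle in its composition, and the stub is
  false in every world in which the route's rank-2 crux has a single instance:
* `packagePinsScale_false_of_twoPoint`:  `isSimpleCompactGroup_specialUnitaryGroup → FemtoCurvatureTwoPoint →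
  ¬ PackagePinsScale` (both hypotheses are named tree statements: the classical simplicity of `SU(n)` and the route's
  own crux 9363).
No engine-free repair of the stub exists: ANY package map has incomparable package companions, so the `∀ a` shell of the
typed crux can only be discharged by restating the crux (planners' R1: bundle `∃ a, Package ∧ Skewness`, what `closes`
consumes) — not inside a line.
-/

noncomputable section

namespace Summit.QuantumFields.YangMills.Theorems.FemtoCurvatureSkewness.Negative

open MeasureTheory Filter Topology Function
open Literature.MathematicalPhysics.QuantumFieldTheory
open Summit.QuantumFields.YangMills.Theses.LangevinControlUV (FemtoCurvatureSkewness FemtoCurvatureTwoPoint)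

/-! ## A two-sided wild unit map -/

/-- `k · log 2 ∈ Λ` for `k : ℤ`. -/
theorem int_mul_log_two_mem_logSpan (k : ℤ) :
    (k : ℝ) * Real.log 2 ∈ (Submodule.span ℚ (Set.range fun n : ℕ => Real.log (n : ℝ))) := by
  have h2 : Real.log ((2 : ℕ) : ℝ) ∈ (Submodule.span ℚ (Set.range fun n : ℕ => Real.log (n : ℝ))) :=
    log_nat_mem_logSpan 2
  have : ((k : ℚ) : ℝ) • Real.log ((2 : ℕ) : ℝ) ∈ (Submodule.span ℚ (Set.range fun n : ℕ => Real.log (n : ℝ))) :=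
    Submodule.smul_mem (Submodule.span ℚ (Set.range fun n : ℕ => Real.log (n : ℝ))) (k : ℚ) h2
  simpa [Rat.cast_intCast, Nat.cast_ofNat] using this

/-- **Two-sided wild exponent**: `h ≤ φ ≤ h + log 2` with pairwise differences outside `Λ` (INTEGER shifts by
`log 2` of the lead's translation-free map). -/
theorem exists_wildExponent_two_sided (h : ℝ → ℝ) :
    ∃ φ : ℝ → ℝ, (∀ x, h x ≤ φ x ∧ φ x ≤ h x + Real.log 2) ∧
      ∀ x y : ℝ, φ x - φ y ∈ (Submodule.span ℚ (Set.range fun n : ℕ => Real.log (n : ℝ))) → x = y := by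
  obtain ⟨t, ht⟩ := exists_translation_free_map
  refine ⟨fun x => t x + (⌈(h x - t x) / Real.log 2⌉ : ℝ) * Real.log 2, fun x => ?_, fun x y hxy => ?_⟩
  · have hlog : 0 < Real.log 2 := Real.log_pos (by norm_num)
    have hceil : (h x - t x) / Real.log 2 ≤ (⌈(h x - t x) / Real.log 2⌉ : ℝ) := Int.le_ceil _
    have hceil' : (⌈(h x - t x) / Real.log 2⌉ : ℝ) < (h x - t x) / Real.log 2 + 1 := Int.ceil_lt_add_one _
    have h1 := mul_le_mul_of_nonneg_right hceil hlog.le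
    have h2 := mul_le_mul_of_nonneg_right hceil'.le hlog.le
    rw [div_mul_cancel₀ _ hlog.ne'] at h1
    rw [add_mul, div_mul_cancel₀ _ hlog.ne', one_mul] at h2
    constructor <;> linarith
  · apply ht x y
    have hk : ((⌈(h x - t x) / Real.log 2⌉ : ℝ) * Real.log 2 -
        (⌈(h y - t y) / Real.log 2⌉ : ℝ) * Real.log 2) ∈
          (Submodule.span ℚ (Set.range fun n : ℕ => Real.log (n : ℝ))) :=
      Submodule.sub_mem (Submodule.span ℚ (Set.range fun n : ℕ => Real.log (n : ℝ)))
        (int_mul_log_two_mem_logSpan _) (int_mul_log_two_mem_logSpan _)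
    have heq : t x - t y = (t x + (⌈(h x - t x) / Real.log 2⌉ : ℝ) * Real.log 2 -
        (t y + (⌈(h y - t y) / Real.log 2⌉ : ℝ) * Real.log 2)) -
        ((⌈(h x - t x) / Real.log 2⌉ : ℝ) * Real.log 2 - (⌈(h y - t y) / Real.log 2⌉ : ℝ) * Real.log 2) := by
      ring
    rw [heq]
    exact Submodule.sub_mem (Submodule.span ℚ (Set.range fun n : ℕ => Real.log (n : ℝ))) hxy hk

/-- **The two-sided wild unit map**: for every positive `g` there is `a` with `g/2 ≤ a ≤ g` whose level sets are
singletons (`n·a β = n'·a β'` forces `β = β'`, `n = n'`; `√m·a β = n''·a β''` forces `β = β''`, `√m = n''`). -/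
theorem exists_wildMap_two_sided (g : ℝ → ℝ) (hg : ∀ β, 0 < g β) :
    ∃ a : ℝ → ℝ, (∀ β, 0 < a β) ∧ (∀ β, a β ≤ g β) ∧ (∀ β, g β ≤ 2 * a β) ∧
      (∀ (β β' : ℝ) (n n' : ℕ), 1 ≤ n → 1 ≤ n' → (n : ℝ) * a β = n' * a β' → β = β' ∧ n = n') ∧
      (∀ (β β'' : ℝ) (m n'' : ℕ), 1 ≤ m → 1 ≤ n'' →
        Real.sqrt m * a β = n'' * a β'' → β = β'' ∧ Real.sqrt m = n'') := by
  obtain ⟨φ, hφ, hinj⟩ := exists_wildExponent_two_sided fun β => -Real.log (g β)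
  refine ⟨fun β => Real.exp (-φ β), fun β => Real.exp_pos _, fun β => ?_, fun β => ?_, ?_, ?_⟩
  · have h1 : -φ β ≤ Real.log (g β) := by have := (hφ β).1; linarith
    calc Real.exp (-φ β) ≤ Real.exp (Real.log (g β)) := Real.exp_le_exp.2 h1
      _ = g β := Real.exp_log (hg β)
  · have h1 : Real.log (g β) - Real.log 2 ≤ -φ β := by have := (hφ β).2; linarith
    have h2 : Real.exp (Real.log (g β) - Real.log 2) ≤ Real.exp (-φ β) := Real.exp_le_exp.2 h1
    rw [Real.exp_sub, Real.exp_log (hg β), Real.exp_log (by norm_num : (0 : ℝ) < 2)] at h2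
    linarith [(div_le_iff₀ (by norm_num : (0 : ℝ) < 2)).1 h2]
  · intro β β' n n' hn hn' heq
    have hnpos : (0 : ℝ) < n := by exact_mod_cast hn
    have hn'pos : (0 : ℝ) < n' := by exact_mod_cast hn'
    have hlog := congrArg Real.log heq
    rw [Real.log_mul hnpos.ne' (Real.exp_pos _).ne', Real.log_mul hn'pos.ne' (Real.exp_pos _).ne',
      Real.log_exp, Real.log_exp] at hlog
    have hdiff : φ β - φ β' = Real.log n - Real.log n' := by linarith
    have hmem : φ β - φ β' ∈ (Submodule.span ℚ (Set.range fun n : ℕ => Real.log (n : ℝ))) := by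
      rw [hdiff]
      exact Submodule.sub_mem (Submodule.span ℚ (Set.range fun n : ℕ => Real.log (n : ℝ)))
        (log_nat_mem_logSpan n) (log_nat_mem_logSpan n')
    have hββ' : β = β' := hinj β β' hmem
    subst hββ'
    refine ⟨rfl, ?_⟩
    have : (n : ℝ) = n' := by
      have hne : Real.exp (-φ β) ≠ 0 := (Real.exp_pos _).ne'
      exact mul_right_cancel₀ hne heq
    exact_mod_cast this
  · intro β β'' m n'' hm hn'' heq
    have hmpos : (0 : ℝ) < m := by exact_mod_cast hm
    have hsq : 0 < Real.sqrt m := Real.sqrt_pos.2 hmpos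
    have hn''pos : (0 : ℝ) < n'' := by exact_mod_cast hn''
    have hlog := congrArg Real.log heq
    rw [Real.log_mul hsq.ne' (Real.exp_pos _).ne', Real.log_mul hn''pos.ne' (Real.exp_pos _).ne',
      Real.log_exp, Real.log_exp, Real.log_sqrt hmpos.le] at hlog
    have hdiff : φ β - φ β'' = Real.log m / 2 - Real.log n'' := by linarith
    have hmem : φ β - φ β'' ∈ (Submodule.span ℚ (Set.range fun n : ℕ => Real.log (n : ℝ))) := by
      rw [hdiff]; exact half_log_sub_log_mem_logSpan m n''
    have hββ'' : β = β'' := hinj β β'' hmem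
    subst hββ''
    refine ⟨rfl, ?_⟩
    have hne : Real.exp (-φ β) ≠ 0 := (Real.exp_pos _).ne'
    exact mul_right_cancel₀ hne heq

/-! ## Package transfer to a dominating wild map -/

section Transfer

variable {G : Type} [Group G] [TopologicalSpace G] [IsTopologicalGroup G] [CompactSpace G]
  [MeasurableSpace G] [BorelSpace G]

omit [TopologicalSpace G] [IsTopologicalGroup G] [CompactSpace G] [MeasurableSpace G] [BorelSpace G] in
/-- The torus distance is at most the side. -/
theorem torusDist_le {L : ℕ} [NeZero L] (x y : Site 4 L) : torusDist L x y ≤ L := by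
  unfold torusDist
  have hk : ∀ k : Fin 4, (((x k - y k).valMinAbs : ℤ) : ℝ) ^ 2 ≤ ((L : ℝ) / 2) ^ 2 := by
    intro k
    have h1 : (((x k - y k).valMinAbs.natAbs : ℕ) : ℝ) ≤ (L : ℝ) / 2 := by
      have h := ZMod.natAbs_valMinAbs_le (x k - y k)
      calc (((x k - y k).valMinAbs.natAbs : ℕ) : ℝ) ≤ ((L / 2 : ℕ) : ℝ) := by exact_mod_cast h
        _ ≤ (L : ℝ) / 2 := Nat.cast_div_le
    have h2 : |(((x k - y k).valMinAbs : ℤ) : ℝ)| = (((x k - y k).valMinAbs.natAbs : ℕ) : ℝ) := by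
      rw [← Int.cast_abs, ← Int.natCast_natAbs, Int.cast_natCast]
    have h3 : |(((x k - y k).valMinAbs : ℤ) : ℝ)| ≤ (L : ℝ) / 2 := h2 ▸ h1
    have h4 : (0 : ℝ) ≤ (L : ℝ) / 2 := by positivity
    calc (((x k - y k).valMinAbs : ℤ) : ℝ) ^ 2 = |(((x k - y k).valMinAbs : ℤ) : ℝ)| ^ 2 := (sq_abs _).symm
      _ ≤ ((L : ℝ) / 2) ^ 2 := pow_le_pow_left₀ (abs_nonneg _) h3 2
  have hsum : ∑ k : Fin 4, (((x k - y k).valMinAbs : ℤ) : ℝ) ^ 2 ≤ (L : ℝ) ^ 2 := by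
    calc ∑ k : Fin 4, (((x k - y k).valMinAbs : ℤ) : ℝ) ^ 2 ≤ ∑ _k : Fin 4, ((L : ℝ) / 2) ^ 2 :=
          Finset.sum_le_sum fun k _ => hk k
      _ = (L : ℝ) ^ 2 := by simp [Finset.sum_const, Finset.card_univ, Fintype.card_fin]; ring
  calc Real.sqrt (∑ k : Fin 4, (((x k - y k).valMinAbs : ℤ) : ℝ) ^ 2) ≤ Real.sqrt ((L : ℝ) ^ 2) :=
        Real.sqrt_le_sqrt hsum
    _ = L := Real.sqrt_sq (Nat.cast_nonneg L)

/-- **Package transfer.**  If `a₀` carries the two-point package and `a` is a positive unit map (`a → 0`) with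
SINGLETON level sets that dominates `a₀` up to a constant (`a₀ ≤ M·a`: every femto box of `a` is a femto box of `a₀`),
then `a` carries the package too: `Γ(n·a β) := Γ₀(n·a₀ β)` on the levels of `a` (well defined), `Γ := 1` elsewhere;
`β₀`, `c`, `C` unchanged, `ℓ₀ ↦ ℓ₀/M`.  No uniformity, no physics — bookkeeping of the typed clauses. -/
theorem twoPointPackage_transfer (r : LatticeRep G) {a₀ a : ℝ → ℝ} (h₀ : TwoPointPackage r a₀)
    (ha : ∀ β, 0 < a β) (ha0 : Tendsto a atTop (𝓝 0)) {M : ℝ} (hM : 1 ≤ M)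
    (hdom : ∀ β, a₀ β ≤ M * a β)
    (huniq : ∀ (β β' : ℝ) (n n' : ℕ), 1 ≤ n → 1 ≤ n' → (n : ℝ) * a β = n' * a β' → β = β' ∧ n = n')
    (hdist : ∀ (β β'' : ℝ) (m n'' : ℕ), 1 ≤ m → 1 ≤ n'' →
      Real.sqrt m * a β = n'' * a β'' → β = β'' ∧ Real.sqrt m = n'') :
    TwoPointPackage r a := by
  classical
  obtain ⟨Γ₀, β₀, ℓ₀, c, C, hℓ₀, hc, ha₀, ha₀0, hΓ₀, hbox⟩ := h₀
  have hM0 : 0 < M := lt_of_lt_of_le one_pos hM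
  -- the transferred shape function
  let IsLevel : ℝ → Prop := fun s => ∃ p : ℕ × ℝ, 1 ≤ p.1 ∧ s = (p.1 : ℝ) * a p.2
  let Γ : ℝ → ℝ := fun s =>
    if hs : IsLevel s then Γ₀ (((Classical.choose hs).1 : ℝ) * a₀ (Classical.choose hs).2) else 1
  have hΓlevel : ∀ (n : ℕ) (β : ℝ), 1 ≤ n → Γ ((n : ℝ) * a β) = Γ₀ ((n : ℝ) * a₀ β) := by
    intro n β hn
    have hs : IsLevel ((n : ℝ) * a β) := ⟨(n, β), hn, rfl⟩
    have hdef : Γ ((n : ℝ) * a β) = Γ₀ (((Classical.choose hs).1 : ℝ) * a₀ (Classical.choose hs).2) := by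
      simp only [Γ, dif_pos hs]
    rw [hdef]
    obtain ⟨hn', heq⟩ := Classical.choose_spec hs
    obtain ⟨hβ, hnn⟩ := huniq β (Classical.choose hs).2 n (Classical.choose hs).1 hn hn' heq
    rw [← hβ]
    have hcast : ((Classical.choose hs).1 : ℝ) = (n : ℝ) := by exact_mod_cast hnn.symm
    rw [hcast]
  have hΓoff : ∀ s : ℝ, ¬ IsLevel s → Γ s = 1 := fun s hs => by simp only [Γ, dif_neg hs]
  -- admissible data for `a` are admissible for `a₀`
  have hboxes : ∀ (L : ℕ) (β : ℝ), (L : ℝ) * a β ≤ ℓ₀ / M → (L : ℝ) * a₀ β ≤ ℓ₀ := by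
    intro L β hL
    calc (L : ℝ) * a₀ β ≤ (L : ℝ) * (M * a β) := mul_le_mul_of_nonneg_left (hdom β) (Nat.cast_nonneg L)
      _ = M * ((L : ℝ) * a β) := by ring
      _ ≤ M * (ℓ₀ / M) := mul_le_mul_of_nonneg_left hL hM0.le
      _ = ℓ₀ := mul_div_cancel₀ _ hM0.ne'
  refine ⟨Γ, β₀, ℓ₀ / M, c, C, div_pos hℓ₀ hM0, hc, ha, ha0, ?_, ?_⟩
  · -- `Γ ∈ (0, 1]` on `(0, ℓ₀/M]`
    intro s hs hsℓ
    by_cases hl : IsLevel s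
    · obtain ⟨p, hp1, rfl⟩ := hl
      rw [hΓlevel p.1 p.2 hp1]
      have hp1' : (1 : ℝ) ≤ p.1 := by exact_mod_cast hp1
      refine hΓ₀ _ (mul_pos (by linarith) (ha₀ p.2)) ?_
      calc (p.1 : ℝ) * a₀ p.2 ≤ (p.1 : ℝ) * (M * a p.2) := mul_le_mul_of_nonneg_left (hdom p.2) (by linarith)
        _ = M * ((p.1 : ℝ) * a p.2) := by ring
        _ ≤ M * (ℓ₀ / M) := mul_le_mul_of_nonneg_left hsℓ hM0.le
        _ = ℓ₀ := mul_div_cancel₀ _ hM0.ne'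
    · rw [hΓoff s hl]; exact ⟨one_pos, le_rfl⟩
  · intro L _ β hβ hL
    obtain ⟨hax, hall⟩ := hbox L β hβ (hboxes L β hL)
    refine ⟨fun n hn h8 => ?_, fun x y i j i' j' hxy hij hij' => ?_⟩
    · rw [hΓlevel n β hn]; exact hax n hn h8
    · have hpair := hall x y i j i' j' hxy hij hij'
      obtain ⟨m, hm1, hdm⟩ := torusDist_eq_sqrt_nat x y hxy
      by_cases hl : IsLevel (torusDist L x y * a β)
      · obtain ⟨p, hp1, heq⟩ := hl
        rw [hdm] at heq
        obtain ⟨hββ, hsq⟩ := hdist β p.2 m p.1 hm1 hp1 heq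
        have hd : torusDist L x y = (p.1 : ℝ) := by rw [hdm, hsq]
        rw [hd, hΓlevel p.1 β hp1]
        rw [hd] at hpair
        exact hpair
      · rw [hΓoff _ hl, mul_one]
        -- `Γ₀ (d·a₀ β) ∈ (0, 1]` since `0 < d ≤ L` and `L·a₀ β ≤ ℓ₀`
        have hdpos : 0 < torusDist L x y := by
          rw [hdm]; exact Real.sqrt_pos.2 (by exact_mod_cast hm1)
        have hdℓ : torusDist L x y * a₀ β ≤ ℓ₀ :=
          le_trans (mul_le_mul_of_nonneg_right (torusDist_le x y) (ha₀ β).le) (hboxes L β hL)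
        obtain ⟨hΓpos, hΓle⟩ := hΓ₀ _ (mul_pos hdpos (ha₀ β)) hdℓ
        have hnonneg : 0 ≤ |wCov r L β (plaq r L x i j) (plaq r L y i' j')| * torusDist L x y ^ 8 := by
          positivity
        have hC : 0 ≤ C := le_of_mul_le_mul_right (by linarith) hΓpos
        exact hpair.trans (by nlinarith)

/-- **From one package map, an incomparable one.**  If `a₀` carries the package then so does a wild map `a` squeezed
between `g/2` and `g`, `g := √a₀ + a₀` (so `a₀ ≤ 2a`, boxes contained; `a₀/a ≤ 2√a₀ → 0`, incomparable). -/
theorem exists_incomparable_package_of_package (r : LatticeRep G) {a₀ : ℝ → ℝ} (h₀ : TwoPointPackage r a₀) :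
    ∃ a : ℝ → ℝ, TwoPointPackage r a ∧ ∀ ε : ℝ, 0 < ε → ∀ β₂ : ℝ, ∃ β : ℝ, β₂ ≤ β ∧ a₀ β < ε * a β := by
  obtain ⟨Γ₀, β₀, ℓ₀, c, C, -, -, ha₀, ha₀0, -⟩ := id h₀
  have hgpos : ∀ β, 0 < Real.sqrt (a₀ β) + a₀ β := fun β =>
    add_pos_of_nonneg_of_pos (Real.sqrt_nonneg _) (ha₀ β)
  have hsqrt0 : Tendsto (fun β => Real.sqrt (a₀ β)) atTop (𝓝 0) := by
    have := (Real.continuous_sqrt.tendsto 0).comp ha₀0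
    rwa [Real.sqrt_zero] at this
  have hg0 : Tendsto (fun β => Real.sqrt (a₀ β) + a₀ β) atTop (𝓝 0) := by
    simpa using hsqrt0.add ha₀0
  obtain ⟨a, ha, hag, hga, huniq, hdist⟩ := exists_wildMap_two_sided (fun β => Real.sqrt (a₀ β) + a₀ β) hgpos
  have ha0 : Tendsto a atTop (𝓝 0) :=
    tendsto_of_tendsto_of_tendsto_of_le_of_le tendsto_const_nhds hg0 (fun β => (ha β).le) hag
  have hdom : ∀ β, a₀ β ≤ 2 * a β := fun β =>
    le_trans (le_add_of_nonneg_left (Real.sqrt_nonneg _)) (hga β)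
  refine ⟨a, twoPointPackage_transfer r h₀ ha ha0 (M := 2) (by norm_num) hdom huniq hdist, fun ε hε β₂ => ?_⟩
  have hev : ∀ᶠ β in atTop, a₀ β ∈ Set.Iio ((ε / 2) ^ 2) :=
    ha₀0.eventually_mem (Iio_mem_nhds (by positivity))
  obtain ⟨β, hβ₂, hβ⟩ := ((eventually_ge_atTop β₂).and hev).exists
  refine ⟨β, hβ₂, ?_⟩
  have hlt : a₀ β < (ε / 2) ^ 2 := hβ
  have hs : Real.sqrt (a₀ β) < ε / 2 := by
    rw [Real.sqrt_lt' (by positivity)]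
    exact hlt
  calc a₀ β = Real.sqrt (a₀ β) * Real.sqrt (a₀ β) := (Real.mul_self_sqrt (ha₀ β).le).symm
    _ < ε / 2 * Real.sqrt (a₀ β) := mul_lt_mul_of_pos_right hs (Real.sqrt_pos.2 (ha₀ β))
    _ ≤ ε / 2 * (Real.sqrt (a₀ β) + a₀ β) :=
        mul_le_mul_of_nonneg_left (le_add_of_nonneg_right (ha₀ β).le) (by positivity)
    _ ≤ ε / 2 * (2 * a β) := mul_le_mul_of_nonneg_left (hga β) (by positivity)
    _ = ε * a β := by ring

end Transfer

/-! ## The residual stub and its characterisation -/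

/-- **Verbatim copy of line `Sketch-ideator3`'s residual stub** `PackagePinsScale` (skeleton
`Cruxes/FemtoCurvatureSkewness/Lines/Sketch_ideator3.lean`): two unit maps carrying the two-point package of
`FemtoCurvatureTwoPoint` (same `G`, `r`) are comparable, `ε·a ≤ a'` for all large `β`. -/
def PackagePinsScale : Prop :=
  ∀ (G : Type) [Group G] [TopologicalSpace G] [IsTopologicalGroup G] [CompactSpace G],
    IsCompactSimpleLieGroup G →
      letI : MeasurableSpace G := borel G
      haveI : BorelSpace G := ⟨rfl⟩
      ∀ (r : LatticeRep G) (a a' : ℝ → ℝ), TwoPointPackage r a → TwoPointPackage r a' →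
        ∃ ε β₂ : ℝ, 0 < ε ∧ ∀ β : ℝ, β₂ ≤ β → ε * a β ≤ a' β

/-- **The residual stub says exactly that the crux's hypothesis is never met.**  `PackagePinsScale` holds iff NO
unit map carries the two-point package, for every compact simple `G` and every `r` — because any package map `a₀`
has an incomparable package companion (`exists_incomparable_package_of_package`).  So the stub (hence the line's
composition for the TYPED crux) lives only in the world where `FemtoCurvatureTwoPoint` fails for every `(G, r)` and the
crux is vacuous. -/
theorem packagePinsScale_iff_package_unsatisfiable : PackagePinsScale ↔
    ∀ (G : Type) [Group G] [TopologicalSpace G] [IsTopologicalGroup G] [CompactSpace G],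
      IsCompactSimpleLieGroup G →
        letI : MeasurableSpace G := borel G
        haveI : BorelSpace G := ⟨rfl⟩
        ∀ (r : LatticeRep G) (a : ℝ → ℝ), ¬ TwoPointPackage r a := by
  constructor
  · intro hP G _ _ _ _ hG
    letI : MeasurableSpace G := borel G
    haveI : BorelSpace G := ⟨rfl⟩
    intro r a₀ h₀
    obtain ⟨a, ha, hinc⟩ := exists_incomparable_package_of_package r h₀
    obtain ⟨ε, β₂, hε, hle⟩ := hP G hG r a a₀ ha h₀
    obtain ⟨β, hβ₂, hlt⟩ := hinc ε hε β₂
    exact absurd (hle β hβ₂) (not_le.2 hlt)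
  · intro hno G _ _ _ _ hG
    letI : MeasurableSpace G := borel G
    haveI : BorelSpace G := ⟨rfl⟩
    intro r a a' ha _
    exact absurd ha (hno G hG r a)

/-- **The stub is false in every world with one instance of the route's rank-2 crux**: given the classical simplicity
of `SU(n)` (tree statement `isSimpleCompactGroup_specialUnitaryGroup`) and `FemtoCurvatureTwoPoint` (crux 9363),
`SU(2)` with any of its faithful unitary representations carries a package map, so `PackagePinsScale` fails. -/
theorem packagePinsScale_false_of_twoPoint
    (hSU : Literature.MathematicalPhysics.QuantumLattice.isSimpleCompactGroup_specialUnitaryGroup.{0})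
    (hTP : FemtoCurvatureTwoPoint) : ¬ PackagePinsScale := by
  intro hP
  have hG : IsCompactSimpleLieGroup (Matrix.specialUnitaryGroup (Fin 2) ℂ) :=
    isCompactSimpleLieGroup_specialUnitaryGroup hSU le_rfl
  letI : MeasurableSpace (Matrix.specialUnitaryGroup (Fin 2) ℂ) := borel _
  haveI : BorelSpace (Matrix.specialUnitaryGroup (Fin 2) ℂ) := ⟨rfl⟩
  obtain ⟨r⟩ := hG.2
  obtain ⟨a, ha⟩ := hTP (Matrix.specialUnitaryGroup (Fin 2) ℂ) hG r
  exact packagePinsScale_iff_package_unsatisfiable.1 hP _ hG r a ha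

end Summit.QuantumFields.YangMills.Theorems.FemtoCurvatureSkewness.Negative
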